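import Summits.BirchSwinnertonDyer.BirchSwinnertonDyer.Theorems.SmallImageMuTransferMuTransferX9LocalExponentBadPrimesUniform
import Literature.NumberTheory.EllipticCurves.WeilPairingTateDual
import Literature.NumberTheory.EllipticCurves.IwasawaTwistModPDual
import HarnessLib

/-!
# K6 crux `MuTransferX9` (stmt-BirchSwinnertonDyer-19276), skeleton v6, G1-LOCAL input (file 3):
# the uniform local exponent for `𝒯_J(E) = E[p] ⊗ 𝔽_p[T]/T^J(χ^{±1})` in the currency of `stub_selmerDualOdd`

Cell `bsd-smallim`, seat `bsd-smallim-k6-g4` gen 0 (route `SmallImageMuTransfer`, rung K6, leaf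
`Rank1Residual.BSDpOnClassX9`). HONEST FRAMING: two corollaries (no definition, no named fact, no
`sorry`); nothing is asserted about any particular curve and nothing is booked; class X9 stays TYPED at
class level. Serves the OPEN registered stub `stub_selmerDualOdd` of crux 19276 (skeleton v6, sha16
a90a661b046bb403) — its clause "`∀ v ∈ S, loc_v ((κ.invTwist.shiftH1 (W.torsionGaloisModule p) _ (J+1))^[ε] Ψ) = 0`"
at the places `v ∤ p` of `S`, for EVERY class `Ψ` and EVERY level, with ONE `ε` — support UNDER k6-c2's
G1 (the place `v = p` and the map `y ↦ Ψ` are k6-c2's), and credits nothing toward the crux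
(`--supports … --as helper`).  PARTITION (D-0054): X9 (A4) × p ∈ {5, 7} (any number field `K : Type`,
any prime `p`, so also X10b ∧ ¬Surj at 3) — helper; closes NONE.

## Content (k6-ty's `WeierstrassCurve.modPTwist W p κ J = κ.twistModP (W.torsionGaloisModule p) _ J`)

* `exists_uniform_localization_shiftH1_modPTwist_of_isCyclotomic` — for an elliptic curve `W/K`, `κ`
  the CYCLOTOMIC `ℤ_p`-extension and a finite set `S` of places `v ∤ p`: ONE `ε` with
  `loc_v ((κ.shiftH1 E[p] _ J)^[ε'] y) = 0` for all `ε' ≥ ε`, `v ∈ S`, `J`, `y ∈ H¹(K, 𝒯_J(E))`.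
* `exists_uniform_localization_shiftH1_modPTwist_invTwist_of_isCyclotomic` — the same for the DUAL
  twist `W.modPTwist p κ.invTwist J` and `κ.invTwist.shiftH1` (`κ⁻¹` has the kernel of `κ`, hence is
  cyclotomic with `κ`): literally the `v ∈ S ∖ {p}` clause of `stub_selmerDualOdd` (take `J ↦ J + 1`).
Both are `exists_uniform_localization_shiftH1_iterate_eq_zero_finset_of_isCyclotomic` (file 2) with
`E[p]` finite (`finite_geomTorsion_of_neZero`).  The (EP) binder
`∀ v, localEulerPoincareCharacteristic (v.adicCompletion ℚ)` of the stub is NOT needed at `v ∤ p`.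

References: HOME/koly/MU-TRANSFER-PROOF.md (F6), §5 STEP 1; R. Greenberg, LNM 1716 (1999) §1
[GreenbergLNM1716]; J. S. Milne, *Arithmetic Duality Theorems* (2006) I Thm. 2.8 [MilneADT2006];
J. H. Silverman, *The Arithmetic of Elliptic Curves* III.6.4 [SilvermanAEC2009].
-/

set_option linter.dupNamespace false
set_option autoImplicit false

noncomputable section

open scoped Classical ContRepresentation

namespace Summit.BirchSwinnertonDyer.BirchSwinnertonDyer.Rank1Residual.LocalSplitPrime

open Function Field NumberField IsDedekindDomain
open Literature.NumberTheory.GaloisRepresentations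
open Literature.NumberTheory.EllipticCurves
open _root_.WeierstrassCurve

section Curve

variable {K : Type} [Field K] [NumberField K] (W : WeierstrassCurve K) [W.IsElliptic]
  (p : ℕ) [Fact p.Prime] (κ : ZpExtension K p)

/-- **The uniform local exponent for `𝒯_J(E)`** (cyclotomic `κ`, finite set `S` of places `v ∤ p`):
ONE `ε` such that `loc_v ((κ.shiftH1 E[p] _ J)^[ε'] y) = 0` for every `ε' ≥ ε`, `v ∈ S`, level `J` and
global `y ∈ H¹(K, 𝒯_J(E))`. [cite: MilneADT2006, Ch. I §2, Thm. 2.8 (p. 31)] [cite: GreenbergLNM1716, §1] -/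
theorem exists_uniform_localization_shiftH1_modPTwist_of_isCyclotomic (hκ : κ.IsCyclotomic)
    (S : Finset (HeightOneSpectrum (𝓞 K))) (hS : ∀ v ∈ S, (p : 𝓞 K) ∉ v.asIdeal) :
    ∃ ε : ℕ, ∀ ⦃ε' : ℕ⦄, ε ≤ ε' → ∀ v ∈ S, ∀ (J : ℕ) (y : galoisCohomology (W.modPTwist p κ J) 1),
      galoisCohomology.localization (W.modPTwist p κ J) (Sum.inr v) 1
        ((κ.shiftH1 (W.torsionGaloisModule (p : ℤ)) (fun P => AddSubgroup.torsionBy.nsmul P) J)^[ε'] y)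
          = 0 := by
  haveI : NeZero p := ⟨(Fact.out : p.Prime).ne_zero⟩
  haveI : Finite (geomTorsion W (p : ℤ)) := finite_geomTorsion_of_neZero W p
  exact exists_uniform_localization_shiftH1_iterate_eq_zero_finset_of_isCyclotomic
    (W.torsionGaloisModule (p : ℤ)) (fun P => AddSubgroup.torsionBy.nsmul P) κ hκ S hS

/-- **The uniform local exponent for the DUAL twist `𝒯_J(E, κ⁻¹)`** — the `v ∈ S ∖ {p}` clause of
`stub_selmerDualOdd` (skeleton v6 of crux 19276) for every class and every level at once: for `κ`
cyclotomic and a finite set `S` of places `v ∤ p`, ONE `ε` with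
`loc_v ((κ.invTwist.shiftH1 E[p] _ J)^[ε'] Ψ) = 0` for all `ε' ≥ ε`, `v ∈ S`, `J`,
`Ψ ∈ H¹(K, W.modPTwist p κ.invTwist J)`. [cite: MilneADT2006, Ch. I §2, Thm. 2.8 (p. 31)] [cite: GreenbergLNM1716, §1] -/
theorem exists_uniform_localization_shiftH1_modPTwist_invTwist_of_isCyclotomic (hκ : κ.IsCyclotomic)
    (S : Finset (HeightOneSpectrum (𝓞 K))) (hS : ∀ v ∈ S, (p : 𝓞 K) ∉ v.asIdeal) :
    ∃ ε : ℕ, ∀ ⦃ε' : ℕ⦄, ε ≤ ε' → ∀ v ∈ S, ∀ (J : ℕ)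
      (Ψ : galoisCohomology (W.modPTwist p κ.invTwist J) 1),
      galoisCohomology.localization (W.modPTwist p κ.invTwist J) (Sum.inr v) 1
        ((κ.invTwist.shiftH1 (W.torsionGaloisModule (p : ℤ)) (fun P => AddSubgroup.torsionBy.nsmul P) J)^[ε']
          Ψ) = 0 := by
  haveI : NeZero p := ⟨(Fact.out : p.Prime).ne_zero⟩
  haveI : Finite (geomTorsion W (p : ℤ)) := finite_geomTorsion_of_neZero W p
  -- `κ⁻¹` has the same kernel as `κ`, hence is cyclotomic with `κ`
  have hκ' : κ.invTwist.IsCyclotomic := by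
    unfold ZpExtension.IsCyclotomic at hκ ⊢
    rw [ZpExtension.invTwist, ZpExtension.kerSubgroup_unitTwist]
    exact hκ
  exact exists_uniform_localization_shiftH1_iterate_eq_zero_finset_of_isCyclotomic
    (W.torsionGaloisModule (p : ℤ)) (fun P => AddSubgroup.torsionBy.nsmul P) κ.invTwist hκ' S hS

end Curve

/-! ## Append no. 1: the `Set`/`Set.Finite` spelling of skeleton v6 (`∃ ε S, S.Finite ∧ S₀ ⊆ S ∧ …`) -/

section CurveSet

variable {K : Type} [Field K] [NumberField K] (W : WeierstrassCurve K) [W.IsElliptic]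
  (p : ℕ) [Fact p.Prime] (κ : ZpExtension K p)

/-- **The dual-twist corollary with a finite `Set` of places** (v6's `stub_selmerDualOdd` quantifies
`∃ (ε : ℕ) (S : Set (HeightOneSpectrum (𝓞 ℚ))), S.Finite ∧ …`): for `κ` cyclotomic and a finite SET `S`
of places, ONE `ε` with `loc_v ((κ.invTwist.shiftH1 E[p] _ J)^[ε'] Ψ) = 0` for all `ε' ≥ ε`, all
`v ∈ S` NOT above `p`, all `J` and all `Ψ ∈ H¹(K, W.modPTwist p κ.invTwist J)` (the places above `p`
in `S` are simply excluded from the conclusion — they are the assembler's per-class clause).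
[cite: MilneADT2006, Ch. I §2, Thm. 2.8 (p. 31)] [cite: GreenbergLNM1716, §1] -/
theorem exists_uniform_localization_shiftH1_modPTwist_invTwist_of_isCyclotomic_of_finite
    (hκ : κ.IsCyclotomic) {S : Set (HeightOneSpectrum (𝓞 K))} (hS : S.Finite) :
    ∃ ε : ℕ, ∀ ⦃ε' : ℕ⦄, ε ≤ ε' → ∀ v ∈ S, (p : 𝓞 K) ∉ v.asIdeal → ∀ (J : ℕ)
      (Ψ : galoisCohomology (W.modPTwist p κ.invTwist J) 1),
      galoisCohomology.localization (W.modPTwist p κ.invTwist J) (Sum.inr v) 1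
        ((κ.invTwist.shiftH1 (W.torsionGaloisModule (p : ℤ)) (fun P => AddSubgroup.torsionBy.nsmul P) J)^[ε']
          Ψ) = 0 := by
  -- the finite set of places of `S` away from `p`
  obtain ⟨ε, hε⟩ := exists_uniform_localization_shiftH1_modPTwist_invTwist_of_isCyclotomic W p κ hκ
    (hS.toFinset.filter fun v => (p : 𝓞 K) ∉ v.asIdeal)
    (fun v hv => (Finset.mem_filter.1 hv).2)
  exact ⟨ε, fun ε' hε' v hv hpv J Ψ =>
    hε hε' v (Finset.mem_filter.2 ⟨hS.mem_toFinset.2 hv, hpv⟩) J Ψ⟩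

/-- The same for the `κ`-twist `W.modPTwist p κ J`. [cite: MilneADT2006, Ch. I §2, Thm. 2.8 (p. 31)]
[cite: GreenbergLNM1716, §1] -/
theorem exists_uniform_localization_shiftH1_modPTwist_of_isCyclotomic_of_finite
    (hκ : κ.IsCyclotomic) {S : Set (HeightOneSpectrum (𝓞 K))} (hS : S.Finite) :
    ∃ ε : ℕ, ∀ ⦃ε' : ℕ⦄, ε ≤ ε' → ∀ v ∈ S, (p : 𝓞 K) ∉ v.asIdeal → ∀ (J : ℕ)
      (y : galoisCohomology (W.modPTwist p κ J) 1),
      galoisCohomology.localization (W.modPTwist p κ J) (Sum.inr v) 1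
        ((κ.shiftH1 (W.torsionGaloisModule (p : ℤ)) (fun P => AddSubgroup.torsionBy.nsmul P) J)^[ε'] y)
          = 0 := by
  obtain ⟨ε, hε⟩ := exists_uniform_localization_shiftH1_modPTwist_of_isCyclotomic W p κ hκ
    (hS.toFinset.filter fun v => (p : 𝓞 K) ∉ v.asIdeal)
    (fun v hv => (Finset.mem_filter.1 hv).2)
  exact ⟨ε, fun ε' hε' v hv hpv J y =>
    hε hε' v (Finset.mem_filter.2 ⟨hS.mem_toFinset.2 hv, hpv⟩) J y⟩

end CurveSet

end Summit.BirchSwinnertonDyer.BirchSwinnertonDyer.Rank1Residual.LocalSplitPrime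

end
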